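import Literature.NumberTheory.Sieve.FriedlanderIwaniecPrimesSmoothCutoff
import Literature.NumberTheory.Sieve.FriedlanderIwaniecPrimesWeylHarmonics
import HarnessLib

/-!
# Friedlander–Iwaniec, *The polynomial `X² + Y⁴` captures its primes*, Lemma 3.1: the Poisson expansion (3.11) of the smoothed congruence sums

Family `parity`, statement parity.S17. Source: J. Friedlander, H. Iwaniec, Ann. of Math. (2) 148
(1998), 945–1040 [FriedlanderIwaniecAnnals1998], §3, proof of Lemma 3.1 (arXiv p. 12):
"In `A_d(f)` we split the summation over `a` into classes modulo `d` getting
`A_d(f) = ∑_b 𝔷(b) ∑_{α² + b² ≡ 0 (d)} ∑_{a ≡ α (d)} f(a² + b²)` … For the nonzero values of `b`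
we expand the above inner sum into Fourier series by Poisson's formula … Hence the smooth sum
`A_d(f)` has the expansion (3.11) `A_d(f) = (2/d) ∑_{b ≠ 0} 𝔷(b) ∑_k ρ(k, b; d) I(k, b; d) + …`
The main term comes from `k = 0` … Estimating the tail of the Fourier series (3.11) trivially …"

This file PROVES the expansion for one slice `b = c²` of FI's sequence and organises the dual sum:

* `fiWeylInt k ℓ d = ρ̃(k, ℓ; d) = ∑_{ν² + ℓ² ≡ 0 (d)} e(νk/d)` for `k ∈ ℤ` (`= fiWeyl k ℓ d` for
  `k ≥ 0`, `ρ̃(-k) = conj ρ̃(k)`, `ρ̃(0) = ρ(ℓ; d)`, `|ρ̃| ≤ ρ(ℓ; d)`);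
* `fiSmoothSlice x y d c = ∑_{|a| ≤ ⌊x⌋, d ∣ a² + c⁴} f(a² + c⁴)` (the slice of the smoothed
  congruence sum `A_d(f)`, with `f = fiCutoff x y` of `FriedlanderIwaniecPrimesSmoothCutoff`);
* **`fiSmoothSlice_eq_tsum`** (FI (3.11) for one slice, PROVED):
  `∑_{d ∣ a² + c⁴} f(a² + c⁴) = d⁻¹ ∑_{k ∈ ℤ} ρ̃(k, c²; d) 𝓕F_c(k/d)`, `F_c(t) = f(t² + c⁴)`
  (residues `a = α + dm` via `Int.divModEquiv`, then `tsum_arithProg_eq_tsum_fourier`);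
* `tsum_dual_eq` (the dual sum split at `k = 0` and folded, `k ↔ -k` being complex conjugate):
  `∑_{k ∈ ℤ} ρ̃(k)𝓕F_c(k/d) = ρ(c²; d) 𝓕F_c(0) + 2 ∑_{k ≥ 1} Re(ρ(k, c²; d) 𝓕F_c(k/d))`;
* `norm_tsum_dual_tail_le` ("estimating the tail … trivially"): for `K ≥ 1`, `n ≥ 2`,
  `|∑_{k > K} ρ(k,c²;d) 𝓕F_c(k/d)| ≤ ρ(c²; d) · 2‖F_c⁽ⁿ⁾‖₁ (d/2π)ⁿ K^{1-n}`.

## References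

* J. Friedlander, H. Iwaniec, Ann. of Math. (2) 148 (1998), 945–1040, §3, (3.11).
  [cite: FriedlanderIwaniecAnnals1998, §3 (3.11)]

## Mathlib / tree search

Tree: `tsum_arithProg_eq_tsum_fourier`, `summable_fourier_div`, `sum_tail_norm_fourier_div_le`,
`fourier_neg_eq_conj` (`…Poisson`); `fiProfileC`, `contDiff_fiProfileC`,
`hasCompactSupport_fiProfileC`, `fiProfileC_eq_zero` (`…SmoothCutoff`); `fiRoots`, `fiWeyl`
(`…WeylHarmonics`). Mathlib: `Int.divModEquiv`, `Equiv.tsum_eq`, `Summable.tsum_prod'`,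
`tsum_fintype`, `Fin.sum_univ_eq_sum_range`, `tsum_eq_sum`, `tsum_of_nat_of_neg_add_one`,
`Summable.tsum_eq_zero_add`, `Summable.sum_add_tsum_nat_add`, `tsum_le_of_sum_range_le`.
-/

noncomputable section

open Finset Real MeasureTheory Filter Complex
open scoped FourierTransform ComplexConjugate ContDiff

namespace Literature.NumberTheory.Sieve.FriedlanderIwaniecPrimes

open LargeSieve

/-! ### The Weyl harmonics at integer frequencies -/

/-- `ρ̃(k, ℓ; d) = ∑_{ν mod d, ν² + ℓ² ≡ 0} e(νk/d)` for `k ∈ ℤ` (FI (3.7) at all integer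
frequencies, as produced by Poisson summation). [cite: FriedlanderIwaniecAnnals1998, §3 (3.7)] -/
def fiWeylInt (k : ℤ) (ℓ d : ℕ) : ℂ := ∑ ν ∈ fiRoots ℓ d, e ((ν : ℝ) * k / d)

/-- `fiWeylInt` unfolded. [cite: FriedlanderIwaniecAnnals1998, §3 (3.7)] -/
theorem fiWeylInt_def (k : ℤ) (ℓ d : ℕ) :
    fiWeylInt k ℓ d = ∑ ν ∈ fiRoots ℓ d, e ((ν : ℝ) * k / d) := rfl

/-- At natural frequencies `ρ̃ = ρ` (`fiWeyl`). [cite: FriedlanderIwaniecAnnals1998, §3 (3.7)] -/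
theorem fiWeylInt_natCast (k ℓ d : ℕ) : fiWeylInt (k : ℤ) ℓ d = fiWeyl k ℓ d := by
  rw [fiWeylInt, fiWeyl]
  simp

/-- `ρ̃(0, ℓ; d) = ρ(ℓ; d)`. [cite: FriedlanderIwaniecAnnals1998, §3, "ρ(0, ℓ; d) = ρ(ℓ; d)"] -/
theorem fiWeylInt_zero (ℓ d : ℕ) : fiWeylInt 0 ℓ d = #(fiRoots ℓ d) := by
  rw [show (0 : ℤ) = ((0 : ℕ) : ℤ) from rfl, fiWeylInt_natCast, fiWeyl_zero_left]

/-- `ρ̃(-k) = conj ρ̃(k)`. [folklore] -/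
theorem fiWeylInt_neg (k : ℤ) (ℓ d : ℕ) : fiWeylInt (-k) ℓ d = conj (fiWeylInt k ℓ d) := by
  rw [fiWeylInt, fiWeylInt, map_sum]
  refine sum_congr rfl fun ν _ => ?_
  rw [conj_e]
  congr 1
  push_cast
  ring

/-- `|ρ̃(k, ℓ; d)| ≤ ρ(ℓ; d)`. [folklore] -/
theorem norm_fiWeylInt_le (k : ℤ) (ℓ d : ℕ) : ‖fiWeylInt k ℓ d‖ ≤ #(fiRoots ℓ d) := by
  rw [fiWeylInt, card_eq_sum_ones, Nat.cast_sum]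
  refine (norm_sum_le _ _).trans (sum_le_sum fun ν _ => ?_)
  rw [norm_e, Nat.cast_one]

/-- The roots indexed by `Fin d`: `∑_{r : Fin d, d ∣ r² + ℓ²} e(rk/d) = ρ̃(k, ℓ; d)`. [folklore] -/
theorem sum_fin_ite_eq_fiWeylInt {d : ℕ} (k : ℤ) (ℓ : ℕ) :
    ∑ r : Fin d, (if d ∣ (r : ℕ) ^ 2 + ℓ ^ 2 then e (((r : ℕ) : ℝ) * k / d) else 0) =
      fiWeylInt k ℓ d := by
  rw [Fin.sum_univ_eq_sum_range (fun r => if d ∣ r ^ 2 + ℓ ^ 2 then e ((r : ℝ) * k / d) else 0),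
    ← sum_filter]
  rfl

/-! ### The smoothed slice and its Poisson expansion -/

/-- The slice `c` of the smoothed congruence sum: `∑_{|a| ≤ ⌊x⌋, d ∣ a² + c⁴} f(a² + c⁴)` with
`f = fiCutoff x y` (so that `f(a² + c⁴) = F_c(a)`, `F_c = fiProfileC x y c⁴`).
[cite: FriedlanderIwaniecAnnals1998, §3, A_d(f) sliced by b = c²] -/
def fiSmoothSlice (x y : ℝ) (d : ℕ) (c : ℤ) : ℂ :=
  ∑ a ∈ (Icc (-(⌊x⌋₊ : ℤ)) ⌊x⌋₊).filter (fun a => (d : ℤ) ∣ a ^ 2 + c ^ 4),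
    fiProfileC x y ((c : ℝ) ^ 4) a

/-- `fiSmoothSlice` unfolded. [cite: FriedlanderIwaniecAnnals1998, §3, A_d(f)] -/
theorem fiSmoothSlice_def (x y : ℝ) (d : ℕ) (c : ℤ) :
    fiSmoothSlice x y d c = ∑ a ∈ (Icc (-(⌊x⌋₊ : ℤ)) ⌊x⌋₊).filter
      (fun a => (d : ℤ) ∣ a ^ 2 + c ^ 4), fiProfileC x y ((c : ℝ) ^ 4) a := rfl

/-- Outside `|a| ≤ ⌊x⌋` the profile vanishes at the integer `a` (`x ≥ 1`, `y > 0`):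
`a² ≥ (⌊x⌋ + 1)² > x`. [folklore] -/
theorem fiProfileC_intCast_eq_zero {x y : ℝ} (hx : 1 ≤ x) (hy : 0 < y) (c : ℤ) {a : ℤ}
    (ha : a ∉ Icc (-(⌊x⌋₊ : ℤ)) ⌊x⌋₊) : fiProfileC x y ((c : ℝ) ^ 4) a = 0 := by
  have hx0 : 0 ≤ x := by linarith
  refine fiProfileC_eq_zero hy (by positivity) hx0 ?_
  rw [mem_Icc, not_and_or, not_le, not_le] at ha
  have hN : (⌊x⌋₊ : ℝ) + 1 ≤ |(a : ℝ)| := by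
    rcases ha with ha | ha
    · have : (a : ℝ) ≤ -(⌊x⌋₊ : ℝ) - 1 := by
        have h' : a ≤ -(⌊x⌋₊ : ℤ) - 1 := by omega
        exact_mod_cast h'
      rw [abs_of_neg (by linarith [Nat.cast_nonneg (α := ℝ) ⌊x⌋₊])]
      linarith
    · have : (⌊x⌋₊ : ℝ) + 1 ≤ a := by
        have h' : (⌊x⌋₊ : ℤ) + 1 ≤ a := by omega
        exact_mod_cast h'
      exact this.trans (le_abs_self _)
  have hlt : x < (⌊x⌋₊ : ℝ) + 1 := Nat.lt_floor_add_one x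
  have hsq : Real.sqrt x ≤ (⌊x⌋₊ : ℝ) + 1 := by
    rw [Real.sqrt_le_left (by positivity)]
    nlinarith
  exact hsq.trans hN

/-- The divisibility `d ∣ a² + c⁴` depends only on `a mod d`: for `a = md + r`,
`d ∣ a² + c⁴ ↔ d ∣ r² + (c²)²` (as naturals). [folklore] -/
theorem int_dvd_iff_nat_dvd {d : ℕ} (m : ℤ) (r : ℕ) (c : ℤ) :
    ((d : ℤ) ∣ (m * d + r) ^ 2 + c ^ 4) ↔ d ∣ r ^ 2 + (c.natAbs ^ 2) ^ 2 := by
  have hc : (((c.natAbs ^ 2) ^ 2 : ℕ) : ℤ) = c ^ 4 := by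
    have h := Int.natAbs_sq c
    push_cast
    rw [sq_abs]
    ring
  have h1 : (m * d + r : ℤ) ^ 2 + c ^ 4 =
      ((r ^ 2 + (c.natAbs ^ 2) ^ 2 : ℕ) : ℤ) + d * (m ^ 2 * d + 2 * m * r) := by
    rw [Nat.cast_add, hc]
    push_cast
    ring
  rw [h1, ← Int.natCast_dvd_natCast]
  exact dvd_add_left (dvd_mul_right _ _)

/-- **FI (3.11) for one slice, PROVED**: for `x ≥ 1`, `0 < y ≤ x`, `d ≥ 1` and any `c`,
`∑_{a ∈ ℤ, d ∣ a² + c⁴} f(a² + c⁴) = d⁻¹ ∑_{k ∈ ℤ} ρ̃(k, c²; d) 𝓕F_c(k/d)`, `F_c(t) = f(t² + c⁴)`: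
split `a` into classes `α mod d` — the condition `d ∣ a² + c⁴` depends only on `α`, and selects
the roots `α² + (c²)² ≡ 0 (mod d)` — and apply Poisson summation along each progression
(`tsum_arithProg_eq_tsum_fourier`). [cite: FriedlanderIwaniecAnnals1998, §3 (3.11)] -/
theorem fiSmoothSlice_eq_tsum {x y : ℝ} (hx : 1 ≤ x) (hy : 0 < y) {d : ℕ} (hd : 0 < d) (c : ℤ) :
    fiSmoothSlice x y d c = (d : ℂ)⁻¹ * ∑' k : ℤ, fiWeylInt k (c.natAbs ^ 2) d *
      𝓕 (fiProfileC x y ((c : ℝ) ^ 4)) ((k : ℝ) / d) := by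
  haveI : NeZero d := ⟨hd.ne'⟩
  have hdr : (0 : ℝ) < d := by exact_mod_cast hd
  set N : ℕ := ⌊x⌋₊ with hN
  set ℓ : ℕ := c.natAbs ^ 2 with hℓ
  set F : ℝ → ℂ := fiProfileC x y ((c : ℝ) ^ 4) with hF
  have hFd : ContDiff ℝ ∞ F := contDiff_fiProfileC _ _ _
  have hFc : HasCompactSupport F := hasCompactSupport_fiProfileC hy (by positivity) (by linarith)
  set G : ℤ → ℂ := fun a => if (d : ℤ) ∣ a ^ 2 + c ^ 4 then F a else 0 with hG
  have hGzero : ∀ a ∉ Icc (-(N : ℤ)) N, G a = 0 := by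
    intro a ha
    simp only [hG]
    split_ifs
    · exact fiProfileC_intCast_eq_zero hx hy c ha
    · rfl
  -- Step 1: the slice is `∑' a, G a`
  have h1 : fiSmoothSlice x y d c = ∑' a : ℤ, G a := by
    rw [tsum_eq_sum (L := SummationFilter.unconditional ℤ) hGzero, fiSmoothSlice, sum_filter]
  -- Step 2: reindex `a = md + r`
  set H : ℤ × Fin d → ℂ := fun p => G (p.1 * d + p.2) with hH
  have h2 : ∑' a : ℤ, G a = ∑' p : ℤ × Fin d, H p := by
    rw [← Equiv.tsum_eq (Int.divModEquiv d).symm]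
    refine tsum_congr fun p => ?_
    rw [Int.divModEquiv_symm_apply]
  have hHzero : ∀ p ∉ (Icc (-(N : ℤ)) N ×ˢ (univ : Finset (Fin d))), H p = 0 := by
    rintro ⟨m, r⟩ hp
    simp only [mem_product, mem_univ, and_true, mem_Icc, not_and_or, not_le] at hp
    refine hGzero _ ?_
    simp only [mem_Icc, not_and_or, not_le]
    have hr0 : (0 : ℤ) ≤ (r : ℕ) := by positivity
    have hrd : ((r : ℕ) : ℤ) < d := by exact_mod_cast r.isLt
    have hd1 : (1 : ℤ) ≤ d := by exact_mod_cast hd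
    rcases hp with hp | hp
    · left; nlinarith
    · right; nlinarith
  have hHsum : Summable H := summable_of_ne_finset_zero hHzero
  have h3 : ∑' p : ℤ × Fin d, H p = ∑ r : Fin d, ∑' m : ℤ, H (m, r) := by
    rw [Summable.tsum_prod' hHsum fun m => (hasSum_fintype _).summable]
    simp_rw [tsum_fintype]
    rw [Summable.tsum_finsetSum fun r _ => ?_]
    exact summable_of_ne_finset_zero (s := Icc (-(N : ℤ)) N) fun m hm =>
      hHzero (m, r) (by simp [hm])
  -- Step 3: each residue class
  have h4 : ∀ r : Fin d, ∑' m : ℤ, H (m, r) =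
      if d ∣ (r : ℕ) ^ 2 + ℓ ^ 2 then
        (d : ℂ)⁻¹ * ∑' k : ℤ, (𝐞 (((r : ℕ) : ℝ) * k / d) : ℂ) * 𝓕 F ((k : ℝ) / d) else 0 := by
    intro r
    by_cases hr : d ∣ (r : ℕ) ^ 2 + ℓ ^ 2
    · rw [if_pos hr]
      have hterm : ∀ m : ℤ, H (m, r) = F ((((r : ℕ) : ℤ) : ℝ) + d * m) := by
        intro m
        simp only [hH, hG]
        rw [if_pos ((int_dvd_iff_nat_dvd m r c).mpr hr)]
        congr 1
        push_cast
        ring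
      simp_rw [hterm]
      have := tsum_arithProg_eq_tsum_fourier hFd hFc hd ((r : ℕ) : ℤ)
      push_cast at this ⊢
      exact this
    · rw [if_neg hr]
      have hterm : ∀ m : ℤ, H (m, r) = 0 := by
        intro m
        simp only [hH, hG]
        rw [if_neg ((int_dvd_iff_nat_dvd m r c).not.mpr hr)]
      simp_rw [hterm, tsum_zero]
  -- Step 4: assemble the dual sum
  have hFsum : Summable fun k : ℤ => 𝓕 F ((k : ℝ) / d) := summable_fourier_div hFd hFc hdr
  have hsum_r : ∀ r : Fin d, Summable fun k : ℤ =>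
      (if d ∣ (r : ℕ) ^ 2 + ℓ ^ 2 then (𝐞 (((r : ℕ) : ℝ) * k / d) : ℂ) else 0) *
        𝓕 F ((k : ℝ) / d) := by
    intro r
    refine Summable.of_norm_bounded hFsum.norm fun k => ?_
    rw [norm_mul]
    refine mul_le_of_le_one_left (norm_nonneg _) ?_
    split_ifs
    · rw [norm_e]
    · rw [norm_zero]; exact zero_le_one
  rw [h1, h2, h3]
  simp_rw [h4]
  calc ∑ r : Fin d, (if d ∣ (r : ℕ) ^ 2 + ℓ ^ 2 then
        (d : ℂ)⁻¹ * ∑' k : ℤ, (𝐞 (((r : ℕ) : ℝ) * k / d) : ℂ) * 𝓕 F ((k : ℝ) / d) else 0)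
      = ∑ r : Fin d, (d : ℂ)⁻¹ * ∑' k : ℤ,
          (if d ∣ (r : ℕ) ^ 2 + ℓ ^ 2 then (𝐞 (((r : ℕ) : ℝ) * k / d) : ℂ) else 0) *
            𝓕 F ((k : ℝ) / d) := by
        refine sum_congr rfl fun r _ => ?_
        split_ifs
        · rfl
        · simp
    _ = (d : ℂ)⁻¹ * ∑' k : ℤ, ∑ r : Fin d,
          (if d ∣ (r : ℕ) ^ 2 + ℓ ^ 2 then (𝐞 (((r : ℕ) : ℝ) * k / d) : ℂ) else 0) *
            𝓕 F ((k : ℝ) / d) := by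
        rw [← mul_sum, Summable.tsum_finsetSum fun r _ => hsum_r r]
    _ = (d : ℂ)⁻¹ * ∑' k : ℤ, fiWeylInt k ℓ d * 𝓕 F ((k : ℝ) / d) := by
        congr 1
        refine tsum_congr fun k => ?_
        rw [← sum_mul, ← sum_fin_ite_eq_fiWeylInt]

/-! ### The dual sum: the term `k = 0`, the folding `k ↔ -k`, and the tail -/

/-- The summands of the dual sum are summable. [folklore] -/
theorem summable_dual {x y : ℝ} (hy : 0 < y) (hyx : y ≤ x) {d : ℕ} (hd : 0 < d) (c : ℤ) :
    Summable fun k : ℤ => fiWeylInt k (c.natAbs ^ 2) d *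
      𝓕 (fiProfileC x y ((c : ℝ) ^ 4)) ((k : ℝ) / d) := by
  have hdr : (0 : ℝ) < d := by exact_mod_cast hd
  have hFsum := summable_fourier_div (contDiff_fiProfileC x y ((c : ℝ) ^ 4))
    (hasCompactSupport_fiProfileC hy (by positivity) (hy.le.trans hyx)) hdr
  refine Summable.of_norm_bounded (hFsum.norm.mul_left (#(fiRoots (c.natAbs ^ 2) d) : ℝ))
    fun k => ?_
  rw [norm_mul]
  exact mul_le_mul_of_nonneg_right (norm_fiWeylInt_le _ _ _) (norm_nonneg _)

/-- The profile is real: `𝓕F_c(-ξ) = conj 𝓕F_c(ξ)`. [folklore] -/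
theorem fourier_fiProfileC_neg (x y h ξ : ℝ) :
    𝓕 (fiProfileC x y h) (-ξ) = conj (𝓕 (fiProfileC x y h) ξ) :=
  fourier_neg_eq_conj (fun t => fiCutoff x y (t ^ 2 + h)) ξ

/-- **The dual sum folded**: `∑_{k ∈ ℤ} ρ̃(k)𝓕F_c(k/d) = ρ(c²; d) 𝓕F_c(0) + 2 ∑_{k ≥ 1} Re(ρ(k, c²; d) 𝓕F_c(k/d))`
("The main term comes from `k = 0` …"; the terms `k` and `-k` are complex conjugate since `f` is
real, which is the `cos` in FI's `I(k, b; d)`). [cite: FriedlanderIwaniecAnnals1998, §3 (3.11) and the display defining M_d(f)] -/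
theorem tsum_dual_eq {x y : ℝ} (hy : 0 < y) (hyx : y ≤ x) {d : ℕ} (hd : 0 < d) (c : ℤ) :
    ∑' k : ℤ, fiWeylInt k (c.natAbs ^ 2) d * 𝓕 (fiProfileC x y ((c : ℝ) ^ 4)) ((k : ℝ) / d) =
      #(fiRoots (c.natAbs ^ 2) d) * 𝓕 (fiProfileC x y ((c : ℝ) ^ 4)) 0 +
        2 * ∑' k : ℕ, (((fiWeyl (k + 1) (c.natAbs ^ 2) d *
          𝓕 (fiProfileC x y ((c : ℝ) ^ 4)) (((k + 1 : ℕ) : ℝ) / d)).re : ℝ) : ℂ) := by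
  set ℓ := c.natAbs ^ 2 with hℓ
  set F := fiProfileC x y ((c : ℝ) ^ 4) with hF
  set g : ℤ → ℂ := fun k => fiWeylInt k ℓ d * 𝓕 F ((k : ℝ) / d) with hg
  have hgs : Summable g := summable_dual hy hyx hd c
  have hnat : Summable fun n : ℕ => g n := hgs.comp_injective Nat.cast_injective
  have hneg : Summable fun n : ℕ => g (-(n + 1 : ℤ)) :=
    hgs.comp_injective fun a b h => by simpa using h
  have hconj : ∀ n : ℕ, g (-((n : ℤ) + 1)) = conj (g ((n + 1 : ℕ) : ℤ)) := by
    intro n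
    have e1 : (((-((n : ℤ) + 1) : ℤ) : ℝ) / d) = -((((n + 1 : ℕ) : ℤ) : ℝ) / d) := by
      push_cast; ring
    have e2 : (-((n : ℤ) + 1) : ℤ) = -(((n + 1 : ℕ) : ℤ)) := by push_cast; ring
    simp only [hg]
    rw [e1, hF, fourier_fiProfileC_neg, e2, fiWeylInt_neg, ← map_mul]
  have hpos : ∀ n : ℕ, g ((n + 1 : ℕ) : ℤ) = fiWeyl (n + 1) ℓ d * 𝓕 F (((n + 1 : ℕ) : ℝ) / d) := by
    intro n
    simp only [hg]
    rw [fiWeylInt_natCast]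
    push_cast
    ring_nf
  change ∑' k : ℤ, g k = _
  rw [tsum_of_nat_of_neg_add_one hnat hneg, hnat.tsum_eq_zero_add]
  have hsum1 : Summable fun n : ℕ => g ((n + 1 : ℕ) : ℤ) := (summable_nat_add_iff 1).mpr hnat
  have hsum2 : Summable fun n : ℕ => conj (g ((n + 1 : ℕ) : ℤ)) := hneg.congr hconj
  rw [tsum_congr hconj, add_assoc, ← hsum1.tsum_add hsum2]
  congr 1
  · simp only [hg, Nat.cast_zero, zero_div, Int.cast_zero]
    rw [fiWeylInt_zero]
  · rw [← tsum_mul_left]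
    refine tsum_congr fun n => ?_
    rw [Complex.add_conj, hpos n]
    push_cast
    ring

/-- **The tail of the dual sum** ("Estimating the tail of the Fourier series (3.11) trivially"):
with `|ρ(k, c²; d)| ≤ ρ(c²; d)` and the decay of `𝓕F_c` from `n ≥ 2` partial integrations
(`sum_tail_norm_fourier_div_le`, `integral_norm_iteratedDeriv_fiProfileC_le`), for `K ≥ 1`,
`∑_{k > K} |ρ(k, c²; d) 𝓕F_c(k/d)| ≤ ρ(c²; d) · 2 (2√x n! Mₙ (2√x/y)ⁿ) (d/(2π))ⁿ K^{1-n}`.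
[cite: FriedlanderIwaniecAnnals1998, §3, proof of Lemma 3.1, tail of (3.11)] -/
theorem tsum_norm_dual_tail_le {x y : ℝ} (hy : 0 < y) (hyx : y ≤ x) {d : ℕ} (hd : 0 < d)
    (c : ℤ) {n : ℕ} (hn : 2 ≤ n) {M : ℝ} (hM0 : 0 ≤ M)
    (hM : ∀ i ≤ n, ∀ s : ℝ, ‖iteratedFDeriv ℝ i Real.smoothTransition s‖ ≤ M) {K : ℕ}
    (hK : 1 ≤ K) :
    ∑' k : ℕ, ‖fiWeyl (k + 1 + K) (c.natAbs ^ 2) d *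
        𝓕 (fiProfileC x y ((c : ℝ) ^ 4)) (((k + 1 + K : ℕ) : ℝ) / d)‖ ≤
      #(fiRoots (c.natAbs ^ 2) d) * (2 * (2 * Real.sqrt x * (n.factorial * M *
        (2 * Real.sqrt x / y) ^ n)) * (d / (2 * π)) ^ n * ((K : ℝ) ^ (n - 1))⁻¹) := by
  have hdr : (0 : ℝ) < d := by exact_mod_cast hd
  set ℓ := c.natAbs ^ 2 with hℓ
  set F := fiProfileC x y ((c : ℝ) ^ 4) with hF
  have hFd : ContDiff ℝ ∞ F := contDiff_fiProfileC _ _ _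
  have hFc : HasCompactSupport F := hasCompactSupport_fiProfileC hy (by positivity) (hy.le.trans hyx)
  have hL1 := integral_norm_iteratedDeriv_fiProfileC_le hy hyx (by positivity : (0:ℝ) ≤ (c:ℝ)^4)
    (n := n) hM0 hM
  set B : ℝ := 2 * (2 * Real.sqrt x * (n.factorial * M * (2 * Real.sqrt x / y) ^ n)) *
    (d / (2 * π)) ^ n * ((K : ℝ) ^ (n - 1))⁻¹ with hB
  refine tsum_le_of_sum_range_le (fun _ => norm_nonneg _) fun m => ?_
  -- the partial sum over `K < k ≤ K + m`
  have hre : ∑ i ∈ range m, ‖fiWeyl (i + 1 + K) ℓ d * 𝓕 F (((i + 1 + K : ℕ) : ℝ) / d)‖ =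
      ∑ k ∈ Ioc K (K + m), ‖fiWeyl k ℓ d * 𝓕 F ((k : ℝ) / d)‖ := by
    refine sum_nbij' (fun i => i + 1 + K) (fun k => k - K - 1) ?_ ?_ ?_ ?_ ?_
    · intro i hi; rw [mem_range] at hi; rw [mem_Ioc]; omega
    · intro k hk; rw [mem_Ioc] at hk; rw [mem_range]; omega
    · intro i _; omega
    · intro k hk; rw [mem_Ioc] at hk; omega
    · intro i _; rfl
  rw [hre]
  calc ∑ k ∈ Ioc K (K + m), ‖fiWeyl k ℓ d * 𝓕 F ((k : ℝ) / d)‖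
      ≤ ∑ k ∈ Ioc K (K + m), #(fiRoots ℓ d) *
          (‖𝓕 F ((k : ℝ) / d)‖ + ‖𝓕 F (-(k : ℝ) / d)‖) := by
        refine sum_le_sum fun k _ => ?_
        rw [norm_mul]
        calc ‖fiWeyl k ℓ d‖ * ‖𝓕 F ((k : ℝ) / d)‖ ≤ #(fiRoots ℓ d) * ‖𝓕 F ((k : ℝ) / d)‖ :=
              mul_le_mul_of_nonneg_right (norm_fiWeyl_le _ _ _) (norm_nonneg _)
          _ ≤ #(fiRoots ℓ d) * (‖𝓕 F ((k : ℝ) / d)‖ + ‖𝓕 F (-(k : ℝ) / d)‖) := by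
              gcongr
              exact le_add_of_nonneg_right (norm_nonneg _)
    _ = #(fiRoots ℓ d) * ∑ k ∈ Ioc K (K + m), (‖𝓕 F ((k : ℝ) / d)‖ + ‖𝓕 F (-(k : ℝ) / d)‖) :=
        (mul_sum _ _ _).symm
    _ ≤ #(fiRoots ℓ d) * (2 * (∫ t, ‖iteratedDeriv n F t‖) * (d / (2 * π)) ^ n *
          ((K : ℝ) ^ (n - 1))⁻¹) :=
        mul_le_mul_of_nonneg_left (sum_tail_norm_fourier_div_le hFd hFc hn hdr hK _)
          (Nat.cast_nonneg _)
    _ ≤ #(fiRoots ℓ d) * B := by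
        rw [hB]
        gcongr

end Literature.NumberTheory.Sieve.FriedlanderIwaniecPrimes
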